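import Mathlib
import Summits.AtomisticToContinuum.Crystallization.Theorems.GappedShellCensusCleanLimitsHaveWindowsLaminarBox

/-!
# `GappedShellCensus.CleanLimitsHaveWindows` (stmt-AtomisticToContinuum-15932), line `Sketch`:
# laminar pinning (stub `stub_laminarPinning`, L3), part 2 — the sharp registry box (three up-bonds in the band)

The landed `laminar_clean_box` confines every registry slip of a gapped-twelve laminar set to the disc of radius
`a/5` about a hollow site. The energy certificate of the laminar pinning needs the sharper raw datum behind it,
recorded here at the level of indices (`lcb_up_bonds_index`) and of sets (`laminar_up_bonds`): for every pair of
consecutive layers `m, m + 1` there are a lattice vector `I u + J v` and a hollow type `δ ∈ {1, 2}` such that, with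
the registry error `η = (w (m+1) - w m) + (I u + J v + (δ/3)(u + v))` and the sign `ε = 3 - 2δ = ±1`, the three
up-bonds `ε η + r`, `r ∈ {-(u + v)/3, (2u - v)/3, (2v - u)/3}`, have squared length
`‖ε η + r‖² + (z (m+1) - z m)² ∈ [(a(1 - 1/50))², (a(1 + 1/50))²]` (three annuli instead of one disc: the error
`η` is confined to a curvilinear hexagon of in-radius `≈ a/25` about the hollow site). Proof: the three indices
above a site found in `…LaminarBox` form a unit lattice triangle; its shape relative to its centroid is one of the
two hollow stars (`lcb_hex_triangle_shape`, `decide`).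
-/

noncomputable section

namespace Summit.AtomisticToContinuum.Crystallization.Theorems.CleanHull

open Literature.MathematicalPhysics.StatisticalMechanics

/-- **Shape of a unit triangle about its centroid.** If `0, e, e'` is a triangle of short indices with
`e + e' ≡ (δ, δ) (mod 3)`, then `3 · {0, e, e'} - (e + e')` is the star `ε · {(-1,-1), (2,-1), (-1,2)}`,
`ε = 3 - 2δ`. [folklore] -/
theorem lcb_hex_triangle_shape : ∀ e ∈ bpHex, ∀ e' ∈ bpHex, e' - e ∈ bpHex →
    ∀ r ∈ ({(-1, -1), (2, -1), (-1, 2)} : Finset (ℤ × ℤ)), ∃ x ∈ ({(0, 0), e, e'} : Finset (ℤ × ℤ)),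
      3 * x.1 - (e.1 + e'.1) = (3 - 2 * ((e.1 + e'.1) % 3)) * r.1 ∧
        3 * x.2 - (e.2 + e'.2) = (3 - 2 * ((e.1 + e'.1) % 3)) * r.2 := by
  decide

/-- **Three up-bonds in the band (index level).** Under the index-level count and separation of a laminar set,
for every `m` there are `I J δ` (`δ ∈ {1, 2}`) such that the three up-bonds `ε η + (ρ₁ u + ρ₂ v)/3`,
`(ρ₁, ρ₂) ∈ {(-1,-1), (2,-1), (-1,2)}`, `ε = 3 - 2δ`, `η = (w (m+1) - w m) + (I u + J v + (δ/3)(u + v))`, have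
squared length plus `(z (m+1) - z m)²` in `[(a(1 - 1/50))², (a(1 + 1/50))²]`. [folklore] -/
theorem lcb_up_bonds_index {a : ℝ} {u v : EuclideanSpace ℝ (Fin 3)} {w : ℤ → EuclideanSpace ℝ (Fin 3)}
    {z : ℤ → ℝ} (ha : 0 < a)
    (hu : a * (1 - 1 / 50) ≤ ‖u‖ ∧ ‖u‖ ≤ a * (1 + 1 / 50))
    (hv : a * (1 - 1 / 50) ≤ ‖v‖ ∧ ‖v‖ ≤ a * (1 + 1 / 50))
    (huv : a * (1 - 1 / 50) ≤ ‖u - v‖ ∧ ‖u - v‖ ≤ a * (1 + 1 / 50))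
    (hu2 : u 2 = 0) (hv2 : v 2 = 0) (hw2 : ∀ m : ℤ, w m 2 = 0) (hz : ∀ m : ℤ, z m < z (m + 1))
    (hcountI : ∀ t₀ : ℤ × ℤ × ℤ, (lcbS a u v w z t₀).ncard = 12)
    (hgapI : ∀ t t' : ℤ × ℤ × ℤ, t ≠ t' → a * (1 - 1 / 50) ≤ dist (lcbPt u v w z t) (lcbPt u v w z t'))
    (m : ℤ) :
    ∃ I J δ : ℤ, (δ = 1 ∨ δ = 2) ∧ ∀ ρ : ℤ × ℤ, ρ ∈ ({(-1, -1), (2, -1), (-1, 2)} : Finset (ℤ × ℤ)) →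
      (a * (1 - 1 / 50)) ^ 2 ≤
          ‖((3 - 2 * δ : ℤ) : ℝ) • ((w (m + 1) - w m) + ((I : ℝ) • u + (J : ℝ) • v + ((δ : ℝ) / 3) • (u + v))) +
              (((ρ.1 : ℝ) / 3) • u + ((ρ.2 : ℝ) / 3) • v)‖ ^ 2 + (z (m + 1) - z m) ^ 2 ∧
        ‖((3 - 2 * δ : ℤ) : ℝ) • ((w (m + 1) - w m) + ((I : ℝ) • u + (J : ℝ) • v + ((δ : ℝ) / 3) • (u + v))) +
              (((ρ.1 : ℝ) / 3) • u + ((ρ.2 : ℝ) / 3) • v)‖ ^ 2 + (z (m + 1) - z m) ^ 2 ≤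
          (a * (1 + 1 / 50)) ^ 2 := by
  -- adapted from the proof of `lcb_box_index` (…LaminarBox): the three indices above `(m, 0, 0)`
  have hhsq : ∀ k : ℤ, 1501 / 2500 * a ^ 2 ≤ (z (k + 1) - z k) ^ 2 :=
    lcb_height_sq_lower ha hu hv huv hu2 hv2 hw2 hgapI
  set t₀ : ℤ × ℤ × ℤ := (m, 0, 0) with ht₀
  have hSfin : (lcbS a u v w z t₀).Finite := Set.finite_of_ncard_pos (by rw [hcountI t₀]; norm_num)
  have hfinU : {t | t ∈ lcbS a u v w z t₀ ∧ t.1 = t₀.1 + 1}.Finite := hSfin.subset fun t ht => ht.1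
  obtain ⟨t₁, t₂, t₃, h₁, h₂, h₃, h12, h13, h23⟩ := (Set.two_lt_ncard_iff hfinU).1
    (lcb_three_above ha hu hv huv hu2 hv2 hw2 hz hhsq hcountI t₀)
  set d : EuclideanSpace ℝ (Fin 3) := w (m + 1) - w m with hd
  set h : ℝ := z (m + 1) - z m with hh
  -- the horizontal offsets of the indices above
  have hoff : ∀ {t : ℤ × ℤ × ℤ}, t ∈ {t | t ∈ lcbS a u v w z t₀ ∧ t.1 = t₀.1 + 1} →
      (a * (1 - 1 / 50)) ^ 2 - h ^ 2 ≤ ‖-d - ((t.2.1 : ℝ) • u + (t.2.2 : ℝ) • v)‖ ^ 2 ∧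
      ‖-d - ((t.2.1 : ℝ) • u + (t.2.2 : ℝ) • v)‖ ^ 2 ≤ (a * (1 + 1 / 50)) ^ 2 - h ^ 2 := by
    intro t ht
    have hl : t.1 = m + 1 := ht.2
    have e : lcbOff u v w t₀ t = ((t.2.1 : ℝ) • u + (t.2.2 : ℝ) • v) + d := by
      simp only [lcbOff, ht₀, hl, sub_zero, hd]
    have en : ‖-d - ((t.2.1 : ℝ) • u + (t.2.2 : ℝ) • v)‖ = ‖lcbOff u v w t₀ t‖ := by
      rw [e, ← norm_neg]; congr 1; abel
    have hzz : (z t.1 - z t₀.1) ^ 2 = h ^ 2 := by rw [hl, hh]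
    have hup := lcb_reach hu2 hv2 hw2 ht.1
    have hlo := pow_le_pow_left₀ (by positivity) (hgapI t₀ t (fun h' => ht.1.1 h'.symm)) 2
    rw [lcb_distSq hu2 hv2 hw2, hzz] at hlo
    rw [hzz] at hup
    rw [en]
    exact ⟨by linarith, hup⟩
  -- pairwise adjacency of the three indices
  have hhm : 1501 / 2500 * a ^ 2 ≤ (z (t₀.1 + 1) - z t₀.1) ^ 2 := hhsq _
  have adj : ∀ {t t' : ℤ × ℤ × ℤ}, t ∈ {t | t ∈ lcbS a u v w z t₀ ∧ t.1 = t₀.1 + 1} →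
      t' ∈ {t | t ∈ lcbS a u v w z t₀ ∧ t.1 = t₀.1 + 1} → t ≠ t' →
      (t'.2.1 - t.2.1, t'.2.2 - t.2.2) ∈ bpHex := by
    intro t t' ht ht' hne
    refine lcb_adjacent ha hu hv huv hu2 hv2 hw2 ht.1 ht'.1 (ht.2.trans ht'.2.symm) hne ?_
    rw [ht.2]; exact hhm
  have e12 := adj h₁ h₂ h12
  have e13 := adj h₁ h₃ h13
  have e23 := adj h₂ h₃ h23
  have e23' : (t₃.2.1 - t₁.2.1, t₃.2.2 - t₁.2.2) - (t₂.2.1 - t₁.2.1, t₂.2.2 - t₁.2.2) ∈ bpHex := by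
    simpa [Prod.mk_sub_mk, sub_sub_sub_cancel_right] using e23
  obtain ⟨hmod, hδ⟩ := lcb_hex_pair_mod _ e12 _ e13 e23'
  have hshape := lcb_hex_triangle_shape _ e12 _ e13 e23'
  simp only at hmod hδ hshape
  -- the hollow site
  set δ : ℤ := (t₂.2.1 - t₁.2.1 + (t₃.2.1 - t₁.2.1)) % 3 with hδdef
  set q₁ : ℤ := (t₂.2.1 - t₁.2.1 + (t₃.2.1 - t₁.2.1)) / 3 with hq₁
  set q₂ : ℤ := (t₂.2.2 - t₁.2.2 + (t₃.2.2 - t₁.2.2)) / 3 with hq₂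
  have hq1 : (t₂.2.1 - t₁.2.1) + (t₃.2.1 - t₁.2.1) = 3 * q₁ + δ := by
    have := Int.mul_ediv_add_emod (t₂.2.1 - t₁.2.1 + (t₃.2.1 - t₁.2.1)) 3
    linarith
  have hq2 : (t₂.2.2 - t₁.2.2) + (t₃.2.2 - t₁.2.2) = 3 * q₂ + δ := by
    have := Int.mul_ediv_add_emod (t₂.2.2 - t₁.2.2 + (t₃.2.2 - t₁.2.2)) 3
    rw [hmod]
    linarith
  refine ⟨t₁.2.1 + q₁, t₁.2.2 + q₂, δ, hδ, fun ρ hρ => ?_⟩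
  obtain ⟨x, hx, hx1, hx2⟩ := hshape ρ hρ
  -- the vertex `t₁ + x` and its band
  have hvert : (a * (1 - 1 / 50)) ^ 2 - h ^ 2 ≤
      ‖-d - (((t₁.2.1 + x.1 : ℤ) : ℝ) • u + ((t₁.2.2 + x.2 : ℤ) : ℝ) • v)‖ ^ 2 ∧
      ‖-d - (((t₁.2.1 + x.1 : ℤ) : ℝ) • u + ((t₁.2.2 + x.2 : ℤ) : ℝ) • v)‖ ^ 2 ≤ (a * (1 + 1 / 50)) ^ 2 - h ^ 2 := by
    simp only [Finset.mem_insert, Finset.mem_singleton] at hx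
    rcases hx with rfl | rfl | rfl
    · simpa using hoff h₁
    · have e1 : t₁.2.1 + (t₂.2.1 - t₁.2.1) = t₂.2.1 := by ring
      have e2 : t₁.2.2 + (t₂.2.2 - t₁.2.2) = t₂.2.2 := by ring
      rw [e1, e2]; exact hoff h₂
    · have e1 : t₁.2.1 + (t₃.2.1 - t₁.2.1) = t₃.2.1 := by ring
      have e2 : t₁.2.2 + (t₃.2.2 - t₁.2.2) = t₃.2.2 := by ring
      rw [e1, e2]; exact hoff h₃
  -- rewrite the bond vector about the hollow site
  have hcast : ((3 - 2 * δ : ℤ) : ℝ) = 3 - 2 * (δ : ℝ) := by push_cast; ring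
  rw [hcast]
  set ε : ℝ := 3 - 2 * (δ : ℝ) with hεdef
  have hε : ε ^ 2 = 1 := by
    rcases hδ with h1 | h1 <;> (rw [hεdef, h1]; norm_num)
  have habs : |ε| = 1 := by
    rcases hδ with h1 | h1 <;> (rw [hεdef, h1]; norm_num)
  have hx1' : (3 : ℝ) * x.1 - (((t₂.2.1 : ℝ) - t₁.2.1) + ((t₃.2.1 : ℝ) - t₁.2.1)) = ε * ρ.1 := by
    rw [hεdef]; exact_mod_cast hx1
  have hx2' : (3 : ℝ) * x.2 - (((t₂.2.2 : ℝ) - t₁.2.2) + ((t₃.2.2 : ℝ) - t₁.2.2)) = ε * ρ.2 := by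
    rw [hεdef]; exact_mod_cast hx2
  have hq1' : ((t₂.2.1 : ℝ) - t₁.2.1) + ((t₃.2.1 : ℝ) - t₁.2.1) = 3 * q₁ + δ := by exact_mod_cast hq1
  have hq2' : ((t₂.2.2 : ℝ) - t₁.2.2) + ((t₃.2.2 : ℝ) - t₁.2.2) = 3 * q₂ + δ := by exact_mod_cast hq2
  have cu : ε * ((t₁.2.1 : ℝ) + q₁) + ε * ((δ : ℝ) / 3) + (ρ.1 : ℝ) / 3 = ε * ((t₁.2.1 : ℝ) + x.1) := by
    linear_combination (-ε / 3) * hq1' + (-ε / 3) * hx1' + (-(ρ.1 : ℝ) / 3) * hε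
  have cv : ε * ((t₁.2.2 : ℝ) + q₂) + ε * ((δ : ℝ) / 3) + (ρ.2 : ℝ) / 3 = ε * ((t₁.2.2 : ℝ) + x.2) := by
    linear_combination (-ε / 3) * hq2' + (-ε / 3) * hx2' + (-(ρ.2 : ℝ) / 3) * hε
  have key : ε • (d + ((((t₁.2.1 + q₁ : ℤ) : ℝ)) • u + (((t₁.2.2 + q₂ : ℤ) : ℝ)) • v +
      ((δ : ℝ) / 3) • (u + v))) + (((ρ.1 : ℝ) / 3) • u + ((ρ.2 : ℝ) / 3) • v) =
      -(ε • (-d - (((t₁.2.1 + x.1 : ℤ) : ℝ) • u + ((t₁.2.2 + x.2 : ℤ) : ℝ) • v))) := by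
    push_cast
    calc ε • (d + (((t₁.2.1 : ℝ) + q₁) • u + ((t₁.2.2 : ℝ) + q₂) • v + ((δ : ℝ) / 3) • (u + v))) +
          (((ρ.1 : ℝ) / 3) • u + ((ρ.2 : ℝ) / 3) • v)
        = ε • d + (ε * ((t₁.2.1 : ℝ) + q₁) + ε * ((δ : ℝ) / 3) + (ρ.1 : ℝ) / 3) • u +
            (ε * ((t₁.2.2 : ℝ) + q₂) + ε * ((δ : ℝ) / 3) + (ρ.2 : ℝ) / 3) • v := by module
      _ = ε • d + (ε * ((t₁.2.1 : ℝ) + x.1)) • u + (ε * ((t₁.2.2 : ℝ) + x.2)) • v := by rw [cu, cv]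
      _ = -(ε • (-d - (((t₁.2.1 : ℝ) + x.1) • u + ((t₁.2.2 : ℝ) + x.2) • v))) := by module
  have hnorm : ‖ε • (d + ((((t₁.2.1 + q₁ : ℤ) : ℝ)) • u + (((t₁.2.2 + q₂ : ℤ) : ℝ)) • v +
      ((δ : ℝ) / 3) • (u + v))) + (((ρ.1 : ℝ) / 3) • u + ((ρ.2 : ℝ) / 3) • v)‖ =
      ‖-d - (((t₁.2.1 + x.1 : ℤ) : ℝ) • u + ((t₁.2.2 + x.2 : ℤ) : ℝ) • v)‖ := by
    rw [key, norm_neg, norm_smul, Real.norm_eq_abs, habs, one_mul]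
  rw [hnorm]
  constructor <;> linarith [hvert.1, hvert.2]

/-- **Three up-bonds in the band (laminar sets).** In a laminar set `Z = v₀ + A {i u + j v + w m + z m • e₃}` that is
gapped-twelve at scale `a`, for every `m` there are `I J δ` (`δ ∈ {1, 2}`) such that the three up-bonds
`ε η + (ρ₁ u + ρ₂ v)/3`, `(ρ₁, ρ₂) ∈ {(-1,-1), (2,-1), (-1,2)}` (`ε = 3 - 2δ`,
`η = (w (m+1) - w m) + (I u + J v + (δ/3)(u + v))` the registry error) have squared length plus
`(z (m+1) - z m)²` in the band `[(a(1 - 1/50))², (a(1 + 1/50))²]` — the sharp form of `laminar_clean_box`.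
[folklore] -/
theorem laminar_up_bonds (a : ℝ) (Z : Set (EuclideanSpace ℝ (Fin 3)))
    (A : EuclideanSpace ℝ (Fin 3) →ₗᵢ[ℝ] EuclideanSpace ℝ (Fin 3)) (u v : EuclideanSpace ℝ (Fin 3))
    (w : ℤ → EuclideanSpace ℝ (Fin 3)) (z : ℤ → ℝ) (v₀ : EuclideanSpace ℝ (Fin 3)) (ha : 0 < a)
    (hclean : ∀ y ∈ Z, {x ∈ Z | x ≠ y ∧ dist y x ≤ a * (1 + 1 / 50)}.ncard = 12 ∧
      ∀ x ∈ Z, x ≠ y → a * (1 - 1 / 50) ≤ dist y x ∧ (dist y x ≤ a * (1 + 1 / 50) ∨ a * (63 / 50) ≤ dist y x))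
    (hu2 : u 2 = 0) (hv2 : v 2 = 0) (hw2 : ∀ m : ℤ, w m 2 = 0)
    (hu : a * (1 - 1 / 50) ≤ ‖u‖ ∧ ‖u‖ ≤ a * (1 + 1 / 50))
    (hv : a * (1 - 1 / 50) ≤ ‖v‖ ∧ ‖v‖ ≤ a * (1 + 1 / 50))
    (huv : a * (1 - 1 / 50) ≤ ‖u - v‖ ∧ ‖u - v‖ ≤ a * (1 + 1 / 50)) (hz : ∀ m : ℤ, z m < z (m + 1))
    (hZ : Z = (fun p => p + v₀) '' {p : EuclideanSpace ℝ (Fin 3) | ∃ m i j : ℤ,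
      p = A (((i : ℝ) • u) + ((j : ℝ) • v) + w m + (z m • layerNormal 1))}) (m : ℤ) :
    ∃ I J δ : ℤ, (δ = 1 ∨ δ = 2) ∧ ∀ ρ : ℤ × ℤ, ρ ∈ ({(-1, -1), (2, -1), (-1, 2)} : Finset (ℤ × ℤ)) →
      (a * (1 - 1 / 50)) ^ 2 ≤
          ‖((3 - 2 * δ : ℤ) : ℝ) • ((w (m + 1) - w m) + ((I : ℝ) • u + (J : ℝ) • v + ((δ : ℝ) / 3) • (u + v))) +
              (((ρ.1 : ℝ) / 3) • u + ((ρ.2 : ℝ) / 3) • v)‖ ^ 2 + (z (m + 1) - z m) ^ 2 ∧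
        ‖((3 - 2 * δ : ℤ) : ℝ) • ((w (m + 1) - w m) + ((I : ℝ) • u + (J : ℝ) • v + ((δ : ℝ) / 3) • (u + v))) +
              (((ρ.1 : ℝ) / 3) • u + ((ρ.2 : ℝ) / 3) • v)‖ ^ 2 + (z (m + 1) - z m) ^ 2 ≤
          (a * (1 + 1 / 50)) ^ 2 := by
  -- adapted from `laminar_clean_box` (…LaminarBox)
  have hzm : StrictMono z := strictMono_int_of_lt_succ hz
  have hinj : Function.Injective (lcbPt u v w z) := lcb_pt_injective ha hu hv huv hu2 hv2 hw2 hzm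
  have hcountI : ∀ t₀ : ℤ × ℤ × ℤ, (lcbS a u v w z t₀).ncard = 12 := fun t₀ =>
    lcb_countI hZ hinj (fun y hy => (hclean y hy).1) t₀
  have hgapI : ∀ t t' : ℤ × ℤ × ℤ, t ≠ t' → a * (1 - 1 / 50) ≤ dist (lcbPt u v w z t) (lcbPt u v w z t') :=
    fun t t' hne => (lcb_gapI hZ hinj (fun y hy => (hclean y hy).2) hne).1
  exact lcb_up_bonds_index ha hu hv huv hu2 hv2 hw2 hz hcountI hgapI m

end Summit.AtomisticToContinuum.Crystallization.Theorems.CleanHull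

end
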